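import Mathlib

/-!
# Route «KPlusLogSqLaw», crux `TropicalB` (stmt-ValiantsHypothesis-19771) — SANDWICHED LATTICE CHAINS (the abstract Newton polygon):
# monotone edge slopes, distinct edge vectors, the ordinate budget and Jarník's two-thirds law

HONEST FRAMING.  Abstract helper lemmas (pure lattice-point combinatorics, no design vocabulary) for the companion file
`KPlusLogSqLawTropicalBNewtonPolygon.lean`, which applies them to dominant chains of dominance designs (registered stub
`stub_tropThin` of `Cruxes/TropicalB/Lines/birth.lean`, crux `Summit.ValiantsHypothesis.ValiantsHypothesis.Theses.KPlusLogSqLaw.TropicalB`,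
item `stmt-ValiantsHypothesis-19771`, route `KPlusLogSqLaw`, DRAFT; cell `pub-symmetroid`, seat val-sym-trop-p1).  Nothing here
bears on `TropicalB`, `KPlusLogSqLaw`, `Lifting`, `MatrixDescartes` (`stmt-ValiantsHypothesis-18050`) or VP ≠ VNP.

SETTING.  A SANDWICHED LATTICE CHAIN of length `n` is a triple of integer sequences `Θ, S, C : ℕ → ℤ` with `Θ i < Θ (i+1)` and
`Θ i · (S (i+1) − S i) < C (i+1) − C i < Θ (i+1) · (S (i+1) − S i)` for `i < n` — exactly what two consecutive dominant terms of a
design satisfy with `S` = slope, `C` = valuation sum, `Θ` = the integer slopes of dominance (`NewtonPolygon.sandwich` in the companion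
file).  The points `(S i, C i)`, `i ≤ n`, are then consecutive vertices of a convex lattice polygon:
* `step_pos` — `S i < S (i+1)`; `cross_lt` — edge slopes strictly increase: `ΔCᵢ·ΔSⱼ < ΔCⱼ·ΔSᵢ` for `i < j`;
* `edge_injOn` — the edge vectors `(ΔSᵢ, ΔCᵢ)` are pairwise distinct; `rise_after` — falling edges precede rising ones;
* `val_budget` — if `B₀ ≤ C ≤ B₁` on `[0, n]` then `n ≤ 2(B₁ − B₀) + 1` and `Σ |ΔC| ≤ 2(B₁ − B₀)`;
* `perimeter_le` — with also `A₀ ≤ S ≤ A₁`: `Σ (ΔS + |ΔC|) ≤ (A₁ − A₀) + 2(B₁ − B₀)`;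
* `small_card_le` — at most `t(2t+1)` edges have `ℓ¹`-size `≤ t` (distinct lattice vectors in `[1,t] × [−t,t]`);
* `key_ineq` — `(t+1)(n − t(2t+1)) ≤ Σ (ΔS + |ΔC|)` for every `t`;
* `cube_le_perimeter_sq` — **Jarník's two-thirds law** `n³ ≤ 24·(Σ (ΔS + |ΔC|))²` (take `t = ⌊√(n/6)⌋`).
[folklore: V. Jarník, Über die Gitterpunkte auf konvexen Kurven, Math. Z. 24 (1926) 500–518; G. E. Andrews, Trans. AMS 106 (1963)
270–279 (higher-dimensional form).]
-/

-- `Summit.ValiantsHypothesis.ValiantsHypothesis.…` repeats a component by the D-0017 layout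
-- (single-conjunct summit), which the `dupNamespace` linter flags; the name is mandated.
set_option linter.dupNamespace false
set_option autoImplicit false

namespace Summit.ValiantsHypothesis.ValiantsHypothesis.Theorems.KPlusLogSqLaw

open scoped BigOperators
open Finset

namespace NewtonPolygon


/-! ## 2. Abstract sandwiched lattice chains (the Newton polygon) -/

section Lattice

variable {n : ℕ} {Θ S C : ℕ → ℤ}

/-- Consecutive strict increase on `[0, n]` gives monotonicity there. [folklore] -/
theorem mono_of_succ_lt (hΘ : ∀ i, i < n → Θ i < Θ (i + 1)) {i j : ℕ} (hij : i ≤ j) (hj : j ≤ n) :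
    Θ i ≤ Θ j := by
  induction j, hij using Nat.le_induction with
  | base => exact le_rfl
  | succ j hij ih => exact (ih (by omega)).trans (hΘ j (by omega)).le

/-- In a sandwiched chain the abscissa steps are positive: `S i < S (i+1)`. [folklore] -/
theorem step_pos (hΘ : ∀ i, i < n → Θ i < Θ (i + 1))
    (hsw : ∀ i, i < n → Θ i * (S (i + 1) - S i) < C (i + 1) - C i ∧
      C (i + 1) - C i < Θ (i + 1) * (S (i + 1) - S i))
    {i : ℕ} (hi : i < n) : S i < S (i + 1) := by
  obtain ⟨h1, h2⟩ := hsw i hi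
  have hθ := hΘ i hi
  by_contra hle
  push Not at hle
  have h3 : Θ (i + 1) * (S (i + 1) - S i) ≤ Θ i * (S (i + 1) - S i) :=
    mul_le_mul_of_nonpos_right hθ.le (by linarith)
  linarith

/-- **Edge slopes strictly increase** along a sandwiched chain: `ΔCᵢ·ΔSⱼ < ΔCⱼ·ΔSᵢ` for steps `i < j`. [folklore] -/
theorem cross_lt (hΘ : ∀ i, i < n → Θ i < Θ (i + 1))
    (hsw : ∀ i, i < n → Θ i * (S (i + 1) - S i) < C (i + 1) - C i ∧
      C (i + 1) - C i < Θ (i + 1) * (S (i + 1) - S i))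
    {i j : ℕ} (hij : i < j) (hj : j < n) :
    (C (i + 1) - C i) * (S (j + 1) - S j) < (C (j + 1) - C j) * (S (i + 1) - S i) := by
  have hi : i < n := lt_trans hij hj
  have hi2 := (hsw i hi).2
  have hj1 := (hsw j hj).1
  have ha := step_pos hΘ hsw hi
  have hb := step_pos hΘ hsw hj
  have hθ : Θ (i + 1) ≤ Θ j := mono_of_succ_lt hΘ (Nat.succ_le_of_lt hij) hj.le
  calc (C (i + 1) - C i) * (S (j + 1) - S j)
      < Θ (i + 1) * (S (i + 1) - S i) * (S (j + 1) - S j) := mul_lt_mul_of_pos_right hi2 (sub_pos.2 hb)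
    _ ≤ Θ j * (S (i + 1) - S i) * (S (j + 1) - S j) := by
        rw [mul_assoc, mul_assoc]
        exact mul_le_mul_of_nonneg_right hθ (mul_pos (sub_pos.2 ha) (sub_pos.2 hb)).le
    _ = Θ j * (S (j + 1) - S j) * (S (i + 1) - S i) := by ring
    _ < (C (j + 1) - C j) * (S (i + 1) - S i) := mul_lt_mul_of_pos_right hj1 (sub_pos.2 ha)

/-- **Edge vectors are pairwise distinct**: the step `i ↦ (ΔSᵢ, ΔCᵢ)` is injective on `[0, n)`. [folklore] -/
theorem edge_injOn (hΘ : ∀ i, i < n → Θ i < Θ (i + 1))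
    (hsw : ∀ i, i < n → Θ i * (S (i + 1) - S i) < C (i + 1) - C i ∧
      C (i + 1) - C i < Θ (i + 1) * (S (i + 1) - S i)) :
    Set.InjOn (fun i => (S (i + 1) - S i, C (i + 1) - C i)) (Set.Iio n) := by
  intro i hi j hj h
  rw [Set.mem_Iio] at hi hj
  simp only [Prod.mk.injEq] at h
  obtain ⟨hs, hc⟩ := h
  by_contra hij
  rcases Nat.lt_or_gt_of_ne hij with hlt | hlt
  · have key := cross_lt hΘ hsw hlt hj
    rw [hs, hc] at key
    exact lt_irrefl _ key
  · have key := cross_lt hΘ hsw hlt hi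
    rw [← hs, ← hc] at key
    exact lt_irrefl _ key

/-- Sign monotonicity: once an edge does not fall (`0 ≤ ΔCᵢ`), every later edge rises (`0 < ΔCⱼ`). [folklore] -/
theorem rise_after (hΘ : ∀ i, i < n → Θ i < Θ (i + 1))
    (hsw : ∀ i, i < n → Θ i * (S (i + 1) - S i) < C (i + 1) - C i ∧
      C (i + 1) - C i < Θ (i + 1) * (S (i + 1) - S i))
    {i j : ℕ} (hij : i < j) (hj : j < n) (h0 : 0 ≤ C (i + 1) - C i) : 0 < C (j + 1) - C j := by
  have hc := cross_lt hΘ hsw hij hj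
  have ha := step_pos hΘ hsw (lt_trans hij hj)
  have hb := step_pos hΘ hsw hj
  have h1 : 0 ≤ (C (i + 1) - C i) * (S (j + 1) - S j) := mul_nonneg h0 (by linarith)
  by_contra hy
  push Not at hy
  nlinarith [hc, h1, ha, hy]

/-- **Valuation budget.**  If the ordinates stay in `[B₀, B₁]` then the chain has at most `2(B₁ − B₀) + 1` steps and its total
vertical variation `Σ |ΔC|` is at most `2(B₁ − B₀)` (falling edges first, each by `≥ 1`; at most one horizontal edge; then rising
edges, each by `≥ 1`). [folklore] -/
theorem val_budget (hΘ : ∀ i, i < n → Θ i < Θ (i + 1))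
    (hsw : ∀ i, i < n → Θ i * (S (i + 1) - S i) < C (i + 1) - C i ∧
      C (i + 1) - C i < Θ (i + 1) * (S (i + 1) - S i))
    {B₀ B₁ : ℤ} (hCb : ∀ i, i ≤ n → B₀ ≤ C i ∧ C i ≤ B₁) :
    (n : ℤ) ≤ 2 * (B₁ - B₀) + 1 ∧ ∑ i ∈ Finset.range n, |C (i + 1) - C i| ≤ 2 * (B₁ - B₀) := by
  classical
  have hex : ∃ i, n ≤ i ∨ 0 ≤ C (i + 1) - C i := ⟨n, Or.inl le_rfl⟩
  -- the switch index: the first non-falling edge (or `n`)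
  obtain ⟨i₀, hi₀spec, hi₀min⟩ : ∃ i₀, (n ≤ i₀ ∨ 0 ≤ C (i₀ + 1) - C i₀) ∧
      ∀ i, i < i₀ → ¬ (n ≤ i ∨ 0 ≤ C (i + 1) - C i) :=
    ⟨Nat.find hex, Nat.find_spec hex, fun i hi => Nat.find_min hex hi⟩
  have hi₀n : i₀ ≤ n := by
    by_contra h
    push Not at h
    exact hi₀min n h (Or.inl le_rfl)
  have hneg : ∀ i, i < i₀ → C (i + 1) - C i < 0 := fun i hi => by
    have h := hi₀min i hi
    push Not at h
    exact h.2
  have hpos : ∀ i, i₀ < i → i < n → 0 < C (i + 1) - C i := fun i hi hin => by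
    rcases hi₀spec with h | h
    · omega
    · exact rise_after hΘ hsw hi hin h
  -- descent on the prefix
  have hpre : ∀ i, i ≤ i₀ → C i + i ≤ C 0 := by
    intro i hi
    induction i with
    | zero => simp
    | succ i ih =>
      have h1 := ih (Nat.le_of_succ_le hi)
      have h2 := hneg i (Nat.lt_of_succ_le hi)
      push_cast
      linarith
  -- ascent on the suffix
  have hsuf : ∀ k, i₀ + 1 + k ≤ n → C (i₀ + 1) + k ≤ C (i₀ + 1 + k) := by
    intro k hk
    induction k with
    | zero => simp
    | succ k ih =>
      have h1 := ih (by omega)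
      have h2 := hpos (i₀ + 1 + k) (by omega) (by omega)
      rw [show i₀ + 1 + (k + 1) = i₀ + 1 + k + 1 by omega]
      push_cast
      linarith
  constructor
  · rcases Nat.lt_or_ge i₀ n with hlt | hge
    · have a := hpre i₀ le_rfl
      have b := hsuf (n - (i₀ + 1)) (by omega)
      rw [show i₀ + 1 + (n - (i₀ + 1)) = n by omega] at b
      have c0 := hCb 0 (Nat.zero_le _)
      have c1 := hCb i₀ hi₀n
      have c2 := hCb (i₀ + 1) (by omega)
      have c3 := hCb n le_rfl
      have e : ((n - (i₀ + 1) : ℕ) : ℤ) = (n : ℤ) - i₀ - 1 := by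
        rw [Nat.cast_sub (by omega : i₀ + 1 ≤ n)]
        push_cast
        ring
      rw [e] at b
      linarith [c0.2, c1.1, c2.2, c3.1]
    · have heq : i₀ = n := le_antisymm hi₀n hge
      have a := hpre n (by omega)
      have c0 := hCb 0 (Nat.zero_le _)
      have c3 := hCb n le_rfl
      linarith [c0.1, c0.2, c3.1]
  · rw [← Finset.sum_range_add_sum_Ico _ hi₀n]
    have e1 : ∑ i ∈ Finset.range i₀, |C (i + 1) - C i| = ∑ i ∈ Finset.range i₀, (C i - C (i + 1)) := by
      refine Finset.sum_congr rfl fun i hi => ?_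
      rw [Finset.mem_range] at hi
      rw [abs_of_neg (hneg i hi)]
      ring
    have hnn : ∀ i, i₀ ≤ i → i < n → 0 ≤ C (i + 1) - C i := by
      intro i hi hin
      rcases hi.eq_or_lt with h | h
      · subst h
        rcases hi₀spec with h' | h'
        · omega
        · exact h'
      · exact (hpos i h hin).le
    have e2 : ∑ i ∈ Finset.Ico i₀ n, |C (i + 1) - C i| = ∑ i ∈ Finset.Ico i₀ n, (C (i + 1) - C i) := by
      refine Finset.sum_congr rfl fun i hi => ?_
      rw [Finset.mem_Ico] at hi
      exact abs_of_nonneg (hnn i hi.1 hi.2)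
    have e3 : ∑ i ∈ Finset.Ico i₀ n, (C (i + 1) - C i) = C n - C i₀ := by
      rw [Finset.sum_Ico_eq_sum_range]
      have h := Finset.sum_range_sub (fun j => C (i₀ + j)) (n - i₀)
      simp only [Nat.add_zero] at h
      rw [show i₀ + (n - i₀) = n by omega] at h
      rw [← h]
      refine Finset.sum_congr rfl fun j _ => ?_
      rw [show i₀ + j + 1 = i₀ + (j + 1) by omega]
    rw [e1, Finset.sum_range_sub', e2, e3]
    have c0 := hCb 0 (Nat.zero_le _)
    have c1 := hCb i₀ hi₀n
    have c3 := hCb n le_rfl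
    linarith [c0.2, c1.1, c3.2]

/-- The `ℓ¹`-perimeter of the chain is nonnegative. [folklore] -/
theorem perimeter_nonneg (hΘ : ∀ i, i < n → Θ i < Θ (i + 1))
    (hsw : ∀ i, i < n → Θ i * (S (i + 1) - S i) < C (i + 1) - C i ∧
      C (i + 1) - C i < Θ (i + 1) * (S (i + 1) - S i)) :
    0 ≤ ∑ i ∈ Finset.range n, ((S (i + 1) - S i) + |C (i + 1) - C i|) :=
  Finset.sum_nonneg fun i hi => by
    rw [Finset.mem_range] at hi
    have h1 := step_pos hΘ hsw hi
    have h2 := abs_nonneg (C (i + 1) - C i)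
    linarith

/-- **Perimeter bound**: abscissae in `[A₀, A₁]` and ordinates in `[B₀, B₁]` give `Σ (ΔS + |ΔC|) ≤ (A₁ − A₀) + 2(B₁ − B₀)`.
[folklore] -/
theorem perimeter_le (hΘ : ∀ i, i < n → Θ i < Θ (i + 1))
    (hsw : ∀ i, i < n → Θ i * (S (i + 1) - S i) < C (i + 1) - C i ∧
      C (i + 1) - C i < Θ (i + 1) * (S (i + 1) - S i))
    {A₀ A₁ B₀ B₁ : ℤ} (hSb : ∀ i, i ≤ n → A₀ ≤ S i ∧ S i ≤ A₁) (hCb : ∀ i, i ≤ n → B₀ ≤ C i ∧ C i ≤ B₁) :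
    ∑ i ∈ Finset.range n, ((S (i + 1) - S i) + |C (i + 1) - C i|) ≤ (A₁ - A₀) + 2 * (B₁ - B₀) := by
  rw [Finset.sum_add_distrib, Finset.sum_range_sub]
  have h := (val_budget hΘ hsw hCb).2
  have h0 := hSb 0 (Nat.zero_le _)
  have hn := hSb n le_rfl
  linarith [h0.1, hn.2]

/-- **Few short edges**: at most `t(2t+1)` steps have `ℓ¹`-size `ΔS + |ΔC| ≤ t` (pairwise distinct lattice vectors with positive
abscissa inside the box `[1, t] × [−t, t]`). [folklore: Jarník's count] -/
theorem small_card_le (hΘ : ∀ i, i < n → Θ i < Θ (i + 1))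
    (hsw : ∀ i, i < n → Θ i * (S (i + 1) - S i) < C (i + 1) - C i ∧
      C (i + 1) - C i < Θ (i + 1) * (S (i + 1) - S i)) (t : ℕ) :
    ((Finset.range n).filter fun i => (S (i + 1) - S i) + |C (i + 1) - C i| ≤ t).card ≤ t * (2 * t + 1) := by
  classical
  have hcard : ((Finset.Icc (1 : ℤ) t) ×ˢ (Finset.Icc (-(t : ℤ)) t)).card = t * (2 * t + 1) := by
    rw [Finset.card_product, Int.card_Icc, Int.card_Icc]
    have e1 : ((t : ℤ) + 1 - 1).toNat = t := by simp
    have e2 : ((t : ℤ) + 1 - -(t : ℤ)).toNat = 2 * t + 1 := by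
      rw [show (t : ℤ) + 1 - -(t : ℤ) = ((2 * t + 1 : ℕ) : ℤ) by push_cast; ring, Int.toNat_natCast]
    rw [e1, e2]
  rw [← hcard]
  refine Finset.card_le_card_of_injOn (fun i => (S (i + 1) - S i, C (i + 1) - C i)) ?_ ?_
  · intro i hi
    simp only [Finset.coe_filter, Finset.mem_range, Set.mem_setOf_eq] at hi
    obtain ⟨hin, hit⟩ := hi
    have hs := step_pos hΘ hsw hin
    have h1 := neg_abs_le (C (i + 1) - C i)
    have h2 := le_abs_self (C (i + 1) - C i)
    simp only [Finset.coe_product, Finset.coe_Icc, Set.mem_prod, Set.mem_Icc]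
    refine ⟨⟨by linarith, by linarith⟩, by linarith, by linarith⟩
  · intro i hi j hj h
    simp only [Finset.coe_filter, Finset.mem_range, Set.mem_setOf_eq] at hi hj
    exact edge_injOn hΘ hsw (Set.mem_Iio.2 hi.1) (Set.mem_Iio.2 hj.1) h

/-- **Key inequality**: for every `t`, `(t+1)·(n − t(2t+1)) ≤ Σ (ΔS + |ΔC|)` (the steps of size `> t` each contribute `≥ t+1`).
[folklore: Jarník] -/
theorem key_ineq (hΘ : ∀ i, i < n → Θ i < Θ (i + 1))
    (hsw : ∀ i, i < n → Θ i * (S (i + 1) - S i) < C (i + 1) - C i ∧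
      C (i + 1) - C i < Θ (i + 1) * (S (i + 1) - S i)) (t : ℕ) :
    ((t : ℤ) + 1) * ((n : ℤ) - t * (2 * t + 1)) ≤ ∑ i ∈ Finset.range n, ((S (i + 1) - S i) + |C (i + 1) - C i|) := by
  classical
  rw [← Finset.sum_filter_add_sum_filter_not (Finset.range n)
    (fun i => (S (i + 1) - S i) + |C (i + 1) - C i| ≤ t)]
  have hsmall := small_card_le hΘ hsw t
  have hcardn := Finset.card_filter_add_card_filter_not (s := Finset.range n)
    (fun i => (S (i + 1) - S i) + |C (i + 1) - C i| ≤ t)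
  rw [Finset.card_range] at hcardn
  have hbig : ((((Finset.range n).filter fun i => ¬ ((S (i + 1) - S i) + |C (i + 1) - C i| ≤ t)).card : ℤ)) *
      ((t : ℤ) + 1) ≤
      ∑ i ∈ (Finset.range n).filter (fun i => ¬ ((S (i + 1) - S i) + |C (i + 1) - C i| ≤ t)),
        ((S (i + 1) - S i) + |C (i + 1) - C i|) := by
    have h := Finset.card_nsmul_le_sum
      ((Finset.range n).filter fun i => ¬ ((S (i + 1) - S i) + |C (i + 1) - C i| ≤ t))
      (fun i => (S (i + 1) - S i) + |C (i + 1) - C i|) ((t : ℤ) + 1)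
      (fun i hi => by
        rw [Finset.mem_filter] at hi
        have h' := hi.2
        push Not at h'
        linarith)
    rwa [nsmul_eq_mul] at h
  have hsmall0 : 0 ≤ ∑ i ∈ (Finset.range n).filter (fun i => (S (i + 1) - S i) + |C (i + 1) - C i| ≤ t),
      ((S (i + 1) - S i) + |C (i + 1) - C i|) :=
    Finset.sum_nonneg fun i hi => by
      rw [Finset.mem_filter, Finset.mem_range] at hi
      have h1 := step_pos hΘ hsw hi.1
      have h2 := abs_nonneg (C (i + 1) - C i)
      linarith
  have hc : (n : ℤ) - t * (2 * t + 1) ≤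
      (((Finset.range n).filter fun i => ¬ ((S (i + 1) - S i) + |C (i + 1) - C i| ≤ t)).card : ℤ) := by
    have h1 : ((((Finset.range n).filter fun i => (S (i + 1) - S i) + |C (i + 1) - C i| ≤ t).card : ℤ)) ≤
        (t : ℤ) * (2 * t + 1) := by exact_mod_cast hsmall
    have h2 : ((((Finset.range n).filter fun i => (S (i + 1) - S i) + |C (i + 1) - C i| ≤ t).card : ℤ)) +
        (((Finset.range n).filter fun i => ¬ ((S (i + 1) - S i) + |C (i + 1) - C i| ≤ t)).card : ℤ) = n := by
      exact_mod_cast hcardn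
    linarith
  calc ((t : ℤ) + 1) * ((n : ℤ) - t * (2 * t + 1))
      ≤ ((t : ℤ) + 1) *
          (((Finset.range n).filter fun i => ¬ ((S (i + 1) - S i) + |C (i + 1) - C i| ≤ t)).card : ℤ) :=
        mul_le_mul_of_nonneg_left hc (by positivity)
    _ = (((Finset.range n).filter fun i => ¬ ((S (i + 1) - S i) + |C (i + 1) - C i| ≤ t)).card : ℤ) *
          ((t : ℤ) + 1) := mul_comm _ _
    _ ≤ ∑ i ∈ (Finset.range n).filter (fun i => ¬ ((S (i + 1) - S i) + |C (i + 1) - C i| ≤ t)),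
          ((S (i + 1) - S i) + |C (i + 1) - C i|) := hbig
    _ ≤ _ := le_add_of_nonneg_left hsmall0

/-- **Jarník's two-thirds law** for sandwiched lattice chains: `n³ ≤ 24·(Σ (ΔS + |ΔC|))²`. [folklore: Jarník 1926] -/
theorem cube_le_perimeter_sq (hΘ : ∀ i, i < n → Θ i < Θ (i + 1))
    (hsw : ∀ i, i < n → Θ i * (S (i + 1) - S i) < C (i + 1) - C i ∧
      C (i + 1) - C i < Θ (i + 1) * (S (i + 1) - S i)) :
    (n : ℤ) ^ 3 ≤ 24 * (∑ i ∈ Finset.range n, ((S (i + 1) - S i) + |C (i + 1) - C i|)) ^ 2 := by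
  have hP0 := perimeter_nonneg hΘ hsw
  -- `t = ⌊√(n/6)⌋`
  have hk := key_ineq hΘ hsw (Nat.sqrt (n / 6))
  revert hP0 hk
  generalize ∑ i ∈ Finset.range n, ((S (i + 1) - S i) + |C (i + 1) - C i|) = P
  generalize ht : Nat.sqrt (n / 6) = t
  intro hP0 hk
  have h1 : 6 * t ^ 2 ≤ n := by
    rw [← ht]
    exact le_trans (Nat.mul_le_mul_left 6 (Nat.sqrt_le' _)) (Nat.mul_div_le n 6)
  have h2 : n + 1 ≤ 6 * (t + 1) ^ 2 := by
    rw [← ht]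
    have a := Nat.lt_mul_div_succ n (show 0 < 6 by norm_num)
    have b : n / 6 + 1 ≤ (Nat.sqrt (n / 6) + 1) ^ 2 := Nat.lt_succ_sqrt' (n / 6)
    calc n + 1 ≤ 6 * (n / 6 + 1) := a
      _ ≤ 6 * (Nat.sqrt (n / 6) + 1) ^ 2 := Nat.mul_le_mul_left 6 b
  have h1' : 6 * (t : ℤ) ^ 2 ≤ n := by exact_mod_cast h1
  have h2' : (n : ℤ) + 1 ≤ 6 * ((t : ℤ) + 1) ^ 2 := by exact_mod_cast h2
  have ht0 : (0 : ℤ) ≤ (t : ℤ) * ((t : ℤ) - 1) := by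
    rcases Nat.eq_zero_or_pos t with h | h
    · simp [h]
    · have : (1 : ℤ) ≤ t := by exact_mod_cast h
      nlinarith
  -- `n ≤ 2 (n − t(2t+1))`
  have h3 : (n : ℤ) ≤ 2 * ((n : ℤ) - t * (2 * t + 1)) := by nlinarith [h1', ht0]
  -- `(t+1) n ≤ 2 P`
  have h4 : ((t : ℤ) + 1) * n ≤ 2 * P := by nlinarith [hk, h3]
  have h5 : (((t : ℤ) + 1) * n) ^ 2 ≤ (2 * P) ^ 2 := pow_le_pow_left₀ (by positivity) h4 2
  calc (n : ℤ) ^ 3 ≤ (n : ℤ) ^ 2 * ((n : ℤ) + 1) := by nlinarith [sq_nonneg (n : ℤ)]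
    _ ≤ (n : ℤ) ^ 2 * (6 * ((t : ℤ) + 1) ^ 2) := mul_le_mul_of_nonneg_left h2' (sq_nonneg _)
    _ = 6 * (((t : ℤ) + 1) * n) ^ 2 := by ring
    _ ≤ 6 * (2 * P) ^ 2 := by linarith [h5]
    _ = 24 * P ^ 2 := by ring

end Lattice

end NewtonPolygon

end Summit.ValiantsHypothesis.ValiantsHypothesis.Theorems.KPlusLogSqLaw
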